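import Mathlib
import Literature.Probability.LatticeModels.GKSInequalities
import Literature.LinearAlgebra.Matrix.InverseMMatrixProofs
import Summits.CriticalPhenomena.Ising3DConformalLimit.Theses.PrecisionLaplacian
import HarnessLib

/-!
# Crux `PrecisionLaplacian.InverseMFerromagnet` (stmt-CriticalPhenomena-4798), line `Sketch` —
# stub `stub_pcov_of_im` (last link of the core chain)

THEOREM-ONLY file (no definitions).  Let `G = (⟨σ_pσ_q⟩)_{p,q}` be the spin second-moment matrix
of the zero-field pair ferromagnet `gksExpect univ K C` on `Fin n` (`K ≥ 0`, `|C_i| = 2`), let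
`x ≠ y` and let `S ⊆ Fin n ∖ {x, y}` be ANY conditioning set.  This file proves

  `IM ⟹ PCov(x,y|S) := G_xy − G_{xS} (G_SS)⁻¹ G_{Sy} ≥ 0`,

where `IM` (`InverseMFerromagnet`) says that `G⁻¹` is a Z-matrix for every such model.

Proof.  (1) `G` is an inverse M-matrix: entrywise `≥ 0` by GKS I, nonsingular because positive
definite (`pcov_posDef_of_eq`, the argument of the landed sibling `…EntryNonposOfPcov.lean`'s
`schur_posDef`, whose olean is not yet served by the farm, restated for `G` given by an equation),
and `G⁻¹` is a Z-matrix by `IM`.  (2) By DMS Lemma 2.32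
(`principalSubmatrix_closure_holds`, proved in the tree) the principal submatrix `H = G_TT`,
`T = S ∪ {x, y}`, is again an inverse M-matrix, so `(H⁻¹)_xy ≤ 0`; and `H` is positive definite.
(3) Converse Schur step (`pcov_schur_converse`, the computation of the landed
`schur_inv_entry_nonpos` run backwards, over an arbitrary finite index type with the complement of
`{x, y}` enumerated by an injection `g`): with `Γ = H⁻¹` and `M` the `{x,y}`-Schur complement of
`H_SS` in `H`, reading `Γ H = 1` entrywise gives `Γ_xx M_xy + Γ_xy M_yy = 0`,
`Γ_xy M_xy + Γ_yy M_yy = 1`, whence `Γ_xy = −(Γ_xxΓ_yy − Γ_xy²) M_xy`; as the determinant is `> 0`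
and `Γ_xy ≤ 0`, `M_xy ≥ 0`.  (4) `M_xy` is literally `PCov(x,y|S)` (the enumeration `g : ↥S → ↥T`
makes `H.submatrix g g = G_SS` definitionally).
-/

namespace Summit.CriticalPhenomena.Ising3DConformalLimit.Cruxes.InverseMFerromagnet.PartialCovarianceLadder

open Literature.Probability.LatticeModels Finset Matrix
open Summit.CriticalPhenomena.Ising3DConformalLimit.Theses.PrecisionLaplacian (InverseMFerromagnet)

/-! ## Positive definiteness of the second-moment matrix `(⟨σ_pσ_q⟩)`
(the argument of the landed `schur_posDef`, restated for a matrix `G` given by an equation, which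
is the form in which the stub supplies it) -/

/-- **The second-moment matrix `G = (⟨σ_pσ_q⟩)` is positive definite** (for every `n, K, C`, no
sign hypothesis): `vᵀGv = ⟨(∑ v_pσ_p)²⟩ > 0` for `v ≠ 0`, testing on the configuration
`σ_p = sign v_p`, where the integrand is `(∑ |v_p|)² > 0`. [folklore] -/
theorem pcov_posDef_of_eq {n m : ℕ} {K : Fin m → ℝ} {C : Fin m → Finset (Fin n)}
    {G : Matrix (Fin n) (Fin n) ℝ}
    (hG : G = Matrix.of (fun p q : Fin n =>
      gksExpect Finset.univ K C (fun ω => spinAt p ω * spinAt q ω))) :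
    G.PosDef := by
  -- linearity of `⟨·⟩`
  have hlin : ∀ (T : Finset (Fin n)) (g : Fin n → SpinConfig (Fin n) → ℝ),
      gksExpect Finset.univ K C (fun ω => ∑ a ∈ T, g a ω)
        = ∑ a ∈ T, gksExpect Finset.univ K C (g a) := by
    intro T g
    unfold gksExpect gksSum
    rw [← Finset.sum_div]
    congr 1
    simp_rw [Finset.sum_mul]
    rw [Finset.sum_comm]
  have hsmul : ∀ (c : ℝ) (f : SpinConfig (Fin n) → ℝ),
      gksExpect Finset.univ K C (fun ω => c * f ω) = c * gksExpect Finset.univ K C f := by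
    intro c f
    unfold gksExpect gksSum
    simp_rw [mul_assoc]
    rw [← Finset.mul_sum, mul_div_assoc]
  -- the quadratic form `vᵀGv = ⟨(∑ v_pσ_p)²⟩`
  have hquad : ∀ v : Fin n → ℝ, dotProduct v (G.mulVec v)
      = gksExpect Finset.univ K C (fun ω => (∑ p, v p * spinAt p ω) ^ 2) := by
    intro v
    have hsq : (fun ω : SpinConfig (Fin n) => (∑ p, v p * spinAt p ω) ^ 2)
        = fun ω => ∑ p, ∑ q, (v p * v q) * (spinAt p ω * spinAt q ω) := by
      funext ω
      rw [sq, Finset.sum_mul_sum]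
      refine Finset.sum_congr rfl fun p _ => Finset.sum_congr rfl fun q _ => by ring
    rw [hsq, hlin]
    simp only [dotProduct, Matrix.mulVec, hG, Matrix.of_apply]
    refine Finset.sum_congr rfl fun p _ => ?_
    rw [hlin, Finset.mul_sum]
    refine Finset.sum_congr rfl fun q _ => ?_
    rw [hsmul]
    ring
  rw [Matrix.posDef_iff_dotProduct_mulVec]
  refine ⟨?_, fun v hv => ?_⟩
  · refine Matrix.IsHermitian.ext fun p q => ?_
    simp only [hG, Matrix.of_apply, star_trivial]
    exact congrArg _ (funext fun ω => mul_comm _ _)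
  · simp only [star_trivial]
    rw [hquad]
    -- test configuration `σ_p = sign v_p`
    let ω₀ : SpinConfig (Fin n) := fun p => if 0 ≤ v p then 1 else -1
    have hterm : ∀ p, v p * spinAt p ω₀ = |v p| := by
      intro p
      by_cases hp : 0 ≤ v p
      · simp [ω₀, spinAt, hp, abs_of_nonneg hp]
      · simp [ω₀, spinAt, hp, abs_of_neg (lt_of_not_ge hp)]
    obtain ⟨p, hp⟩ : ∃ p, v p ≠ 0 := by
      by_contra hall
      push Not at hall
      exact hv (funext hall)
    have hpos : 0 < ∑ q, |v q| :=
      Finset.sum_pos' (fun q _ => abs_nonneg _) ⟨p, Finset.mem_univ _, abs_pos.mpr hp⟩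
    unfold gksExpect
    refine div_pos ?_ (gksSum_one_pos _ K C)
    unfold gksSum
    apply Finset.sum_pos'
    · intro ω _
      exact mul_nonneg (sq_nonneg _) (gksWeight_pos _ K C ω).le
    · refine ⟨ω₀, Finset.mem_univ _, mul_pos ?_ (gksWeight_pos _ K C ω₀)⟩
      simp_rw [hterm]
      positivity

/-! ## The converse Schur step (pure linear algebra on a positive definite matrix) -/

/-- Splitting a sum over a finite type `ι` into the two points `x ≠ y` and the rest, the rest being
enumerated by an injection `g : κ → ι` onto `ι ∖ {x, y}`. [folklore] -/
theorem pcov_sum_split {ι κ : Type*} [Fintype ι] [Fintype κ] {x y : ι} (hxy : x ≠ y)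
    (g : κ → ι) (hg : Function.Injective g) (hgx : ∀ k, g k ≠ x) (hgy : ∀ k, g k ≠ y)
    (hsurj : ∀ z, z ≠ x → z ≠ y → ∃ k, g k = z) (f : ι → ℝ) :
    ∑ k, f k = f x + f y + ∑ k : κ, f (g k) := by
  classical
  have himage : (Finset.univ : Finset κ).image g = (Finset.univ.erase x).erase y := by
    ext z
    simp only [Finset.mem_image, Finset.mem_univ, true_and, Finset.mem_erase, and_true]
    constructor
    · rintro ⟨k, rfl⟩
      exact ⟨hgy k, hgx k⟩
    · rintro ⟨hzy, hzx⟩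
      exact hsurj z hzx hzy
  have h2 : ∑ k : κ, f (g k) = ∑ z ∈ (Finset.univ.erase x).erase y, f z := by
    rw [← himage, Finset.sum_image fun a _ b _ h => hg h]
  rw [h2, add_assoc, Finset.add_sum_erase _ _ (Finset.mem_erase.2 ⟨hxy.symm, Finset.mem_univ y⟩),
    Finset.add_sum_erase _ _ (Finset.mem_univ x)]

/-- The `{x,y}`-block of a positive definite matrix has positive determinant. [folklore] -/
theorem pcov_det_two_pos {ι : Type*} [Fintype ι] {Γ : Matrix ι ι ℝ} (hΓ : Γ.PosDef) {x y : ι}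
    (hxy : x ≠ y) : 0 < Γ x x * Γ y y - Γ x y * Γ y x := by
  have hinj : Function.Injective ![x, y] := by
    intro a b hab
    fin_cases a <;> fin_cases b
    · rfl
    · exact absurd (by simpa using hab) hxy
    · exact absurd (by simpa using hab) hxy.symm
    · rfl
  have h2 := (hΓ.submatrix hinj).det_pos
  rw [Matrix.det_fin_two] at h2
  simpa [Matrix.submatrix_apply] using h2

/-- **Converse Schur step.** For a positive definite real matrix `G` on a finite type `ι`, `x ≠ y`,
and the complement `ι ∖ {x,y}` enumerated by an injection `g : κ → ι`: if `(G⁻¹)_xy ≤ 0`, then the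
partial covariance `G_xy − ∑_{p,q : κ} G_{x,g p} ((G.submatrix g g)⁻¹)_pq G_{g q,y}` is `≥ 0`.
(Eliminating the `κ`-part of the rows `x, y` of `Γ = G⁻¹` from `Γ G = 1` gives
`Γ_xx M_xy + Γ_xy M_yy = 0`, `Γ_xy M_xy + Γ_yy M_yy = 1` for the Schur complement `M`, so
`Γ_xy = −(Γ_xxΓ_yy − Γ_xy²) M_xy` with a positive determinant.) [folklore] -/
theorem pcov_schur_converse {ι κ : Type*} [Fintype ι] [DecidableEq ι] [Fintype κ] [DecidableEq κ]
    (G : Matrix ι ι ℝ) (hG : G.PosDef) (x y : ι) (hxy : x ≠ y) (g : κ → ι)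
    (hg : Function.Injective g) (hgx : ∀ k, g k ≠ x) (hgy : ∀ k, g k ≠ y)
    (hsurj : ∀ z, z ≠ x → z ≠ y → ∃ k, g k = z) (hinv : G⁻¹ x y ≤ 0) :
    0 ≤ G x y - ∑ p : κ, ∑ q : κ, G x (g p) * (G.submatrix g g)⁻¹ p q * G (g q) y := by
  set D : Matrix κ κ ℝ := G.submatrix g g with hD
  set Γ : Matrix ι ι ℝ := G⁻¹
  have hDpd : D.PosDef := hG.submatrix hg
  have hΓpd : Γ.PosDef := hG.inv
  have hΓG : Γ * G = 1 :=
    Matrix.nonsing_inv_mul G ((Matrix.isUnit_iff_isUnit_det G).mp hG.isUnit)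
  have hDD : D * D⁻¹ = 1 :=
    Matrix.mul_nonsing_inv D ((Matrix.isUnit_iff_isUnit_det D).mp hDpd.isUnit)
  -- the entries of `Γ G = 1`, with the sum split along `{x} ∪ {y} ∪ g(κ)`
  have hE : ∀ i j, Γ i x * G x j + Γ i y * G y j + ∑ k : κ, Γ i (g k) * G (g k) j
      = (1 : Matrix ι ι ℝ) i j := by
    intro i j
    have h := congrFun (congrFun hΓG i) j
    rw [Matrix.mul_apply, pcov_sum_split hxy g hg hgx hgy hsurj] at h
    exact h
  -- the `κ`-part of a row `i ∉ g(κ)` of `Γ`, eliminated with `D⁻¹`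
  have hrow : ∀ i, (∀ k, g k ≠ i) → ∀ q : κ,
      Γ i (g q) = -∑ p : κ, (Γ i x * G x (g p) + Γ i y * G y (g p)) * D⁻¹ p q := by
    intro i hi q
    have h1 : (fun p : κ => Γ i (g p)) ᵥ* D
        = -(fun p : κ => Γ i x * G x (g p) + Γ i y * G y (g p)) := by
      funext j
      have hij : i ≠ g j := (hi j).symm
      have h := hE i (g j)
      rw [Matrix.one_apply_ne hij] at h
      simp only [Matrix.vecMul, dotProduct, Pi.neg_apply, hD, Matrix.submatrix_apply]
      linarith
    have h2 : (fun p : κ => Γ i (g p))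
        = -((fun p : κ => Γ i x * G x (g p) + Γ i y * G y (g p)) ᵥ* D⁻¹) := by
      calc (fun p : κ => Γ i (g p)) = ((fun p : κ => Γ i (g p)) ᵥ* D) ᵥ* D⁻¹ := by
            rw [Matrix.vecMul_vecMul, hDD, Matrix.vecMul_one]
        _ = _ := by rw [h1, Matrix.neg_vecMul]
    have h3 := congrFun h2 q
    simp only [Pi.neg_apply, Matrix.vecMul, dotProduct] at h3
    exact h3
  -- the column-`y` equations `Γ_ix M_xy + Γ_iy M_yy = δ_iy` for `i ∉ g(κ)`
  have hcol : ∀ i, (∀ k, g k ≠ i) →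
      Γ i x * (G x y - ∑ p : κ, ∑ q : κ, G x (g p) * D⁻¹ p q * G (g q) y)
        + Γ i y * (G y y - ∑ p : κ, ∑ q : κ, G y (g p) * D⁻¹ p q * G (g q) y)
        = (1 : Matrix ι ι ℝ) i y := by
    intro i hi
    have hsum : ∑ k : κ, Γ i (g k) * G (g k) y
        = -(Γ i x) * (∑ p : κ, ∑ q : κ, G x (g p) * D⁻¹ p q * G (g q) y)
          + -(Γ i y) * (∑ p : κ, ∑ q : κ, G y (g p) * D⁻¹ p q * G (g q) y) := by
      calc ∑ k : κ, Γ i (g k) * G (g k) y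
          = ∑ k : κ, ∑ p : κ, (-(Γ i x) * (G x (g p) * D⁻¹ p k * G (g k) y)
              + -(Γ i y) * (G y (g p) * D⁻¹ p k * G (g k) y)) := by
            refine Finset.sum_congr rfl fun k _ => ?_
            rw [hrow i hi k, ← Finset.sum_neg_distrib, Finset.sum_mul]
            exact Finset.sum_congr rfl fun p _ => by ring
        _ = ∑ p : κ, ∑ k : κ, (-(Γ i x) * (G x (g p) * D⁻¹ p k * G (g k) y)
              + -(Γ i y) * (G y (g p) * D⁻¹ p k * G (g k) y)) := Finset.sum_comm
        _ = _ := by simp only [Finset.sum_add_distrib, Finset.mul_sum]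
    rw [← hE i y, hsum]
    ring
  have ex := hcol x hgx
  have ey := hcol y hgy
  rw [Matrix.one_apply_ne hxy] at ex
  rw [Matrix.one_apply_eq] at ey
  -- symmetry of `Γ` and positivity of the determinant of its `{x,y}`-block
  have hsym : Γ y x = Γ x y := by
    have h := hΓpd.isHermitian.apply x y
    simpa using h
  have hdet : 0 < Γ x x * Γ y y - Γ x y * Γ x y := by
    have h := pcov_det_two_pos hΓpd hxy
    rwa [hsym] at h
  rw [hsym] at ey
  have hfin : Γ x y = -((Γ x x * Γ y y - Γ x y * Γ x y)
      * (G x y - ∑ p : κ, ∑ q : κ, G x (g p) * D⁻¹ p q * G (g q) y)) := by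
    linear_combination Γ y y * ex - Γ x y * ey
  rw [hfin] at hinv
  exact nonneg_of_mul_nonneg_right (neg_nonpos.mp hinv) hdet

/-! ## The registered stub -/

/-- Registered stub `stub_pcov_of_im` (last link of the core chain of line `Sketch`): the crux
`InverseMFerromagnet` implies that, for the spin second-moment matrix `G = (⟨σ_pσ_q⟩)` of a
zero-field pair ferromagnet, `x ≠ y` and ANY conditioning set `S ∌ x, y`, the partial covariance
`G_xy − ∑_{p,q ∈ S} G_xp ((G_SS)⁻¹)_pq G_qy` is nonnegative.  `G` is an inverse M-matrix (GKS I,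
`pcov_posDef_of_eq`, `IM`), hence so is its principal submatrix on `T = S ∪ {x,y}` (DMS Lemma 2.32,
`principalSubmatrix_closure_holds`), and the converse Schur step `pcov_schur_converse` on that
submatrix concludes. [folklore] -/
theorem stub_pcov_of_im : InverseMFerromagnet → ∀ (n m : ℕ) (K : Fin m → ℝ) (C : Fin m → Finset (Fin n)), (∀ i, 0 ≤ K i) → (∀ i, (C i).card = 2) → ∀ G : Matrix (Fin n) (Fin n) ℝ, G = Matrix.of (fun p q : Fin n => gksExpect Finset.univ K C (fun ω => spinAt p ω * spinAt q ω)) → ∀ (x y : Fin n) (S : Finset (Fin n)), x ≠ y → x ∉ S → y ∉ S → 0 ≤ G x y - ∑ p : ↥S, ∑ q : ↥S, G x p.1 * (G.submatrix (Subtype.val : ↥S → Fin n) (Subtype.val : ↥S → Fin n))⁻¹ p q * G q.1 y := by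
  intro hIM n m K C hK hC G hG x y S hxy hx hy
  -- (1) `G` is positive definite and an inverse M-matrix
  have hPD : G.PosDef := pcov_posDef_of_eq hG
  have hIMG : Literature.LinearAlgebra.Matrix.IsInverseMMatrix G := by
    refine ⟨fun p q => ?_, (Matrix.isUnit_iff_isUnit_det G).mp hPD.isUnit, ?_⟩
    · simp only [hG, Matrix.of_apply]
      by_cases hpq : p = q
      · subst hpq
        simp only [spinAt_mul_self]
        unfold gksExpect
        rw [div_self (gksSum_one_pos _ _ _).ne']
        exact zero_le_one
      · have hfun : (fun ω : SpinConfig (Fin n) => spinAt p ω * spinAt q ω) = spinProduct {p, q} := by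
          funext ω
          rw [spinProduct, Finset.prod_pair hpq]
        rw [hfun]
        exact gksExpect_spinProduct_nonneg _ _ _ (fun i _ => hK i) _
    · intro p q hpq
      rw [hG]
      exact hIM n m K C hK hC p q hpq
  -- (2) the principal submatrix on `T = S ∪ {x, y}` is a positive definite inverse M-matrix
  obtain ⟨T, hT⟩ : ∃ T : Finset (Fin n), T = insert x (insert y S) := ⟨_, rfl⟩
  have hxT : x ∈ T := by rw [hT]; exact Finset.mem_insert_self x _
  have hyT : y ∈ T := by rw [hT]; exact Finset.mem_insert_of_mem (Finset.mem_insert_self y S)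
  have hST : ∀ p ∈ S, p ∈ T := fun p hp => by
    rw [hT]; exact Finset.mem_insert_of_mem (Finset.mem_insert_of_mem hp)
  have hHpd : (G.submatrix (Subtype.val : ↥T → Fin n) (Subtype.val : ↥T → Fin n)).PosDef :=
    hPD.submatrix Subtype.val_injective
  have hHim : Literature.LinearAlgebra.Matrix.IsInverseMMatrix
      (G.submatrix (Subtype.val : ↥T → Fin n) (Subtype.val : ↥T → Fin n)) :=
    (Literature.LinearAlgebra.Matrix.principalSubmatrix_closure_holds (Fin n) ↥T G
      (Function.Embedding.subtype _)).1 hIMG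
  have hx' : (⟨x, hxT⟩ : ↥T) ≠ ⟨y, hyT⟩ := fun h => hxy (congrArg Subtype.val h)
  have hinv : (G.submatrix (Subtype.val : ↥T → Fin n) (Subtype.val : ↥T → Fin n))⁻¹
      ⟨x, hxT⟩ ⟨y, hyT⟩ ≤ 0 := hHim.2.2 _ _ hx'
  -- (3) the converse Schur step on `G_TT`, with `S` enumerated inside `T` by `g`
  have hgx : ∀ k : ↥S, (⟨k.1, hST k.1 k.2⟩ : ↥T) ≠ ⟨x, hxT⟩ := fun k h => by
    have h' : k.1 = x := Subtype.mk.inj h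
    exact hx (h' ▸ k.2)
  have hgy : ∀ k : ↥S, (⟨k.1, hST k.1 k.2⟩ : ↥T) ≠ ⟨y, hyT⟩ := fun k h => by
    have h' : k.1 = y := Subtype.mk.inj h
    exact hy (h' ▸ k.2)
  have hsurj : ∀ z : ↥T, z ≠ ⟨x, hxT⟩ → z ≠ ⟨y, hyT⟩ →
      ∃ k : ↥S, (⟨k.1, hST k.1 k.2⟩ : ↥T) = z := by
    rintro ⟨z, hz⟩ hzx hzy
    rw [hT, Finset.mem_insert, Finset.mem_insert] at hz
    rcases hz with rfl | rfl | hzS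
    · exact absurd rfl hzx
    · exact absurd rfl hzy
    · exact ⟨⟨z, hzS⟩, rfl⟩
  have key := pcov_schur_converse _ hHpd ⟨x, hxT⟩ ⟨y, hyT⟩ hx'
    (fun k : ↥S => (⟨k.1, hST k.1 k.2⟩ : ↥T))
    (fun a b h => Subtype.ext (Subtype.mk.inj h)) hgx hgy hsurj hinv
  -- (4) `M_xy` is the partial covariance of the statement
  simpa only [Matrix.submatrix_apply, Matrix.submatrix_submatrix, Function.comp_def] using key

end Summit.CriticalPhenomena.Ising3DConformalLimit.Cruxes.InverseMFerromagnet.PartialCovarianceLadder
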